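import Summits.QuantumAdvantage.QuantumAdvantage.Theorems.ScaleDialA

/-!
# ScaleDial, part B/3: the two one-vertex surgeries of the ring game — the `Y`-stitch (local complementation, lens-1 g10
core) and the `00`-fold (lens-1 g4 core), re-derived: `rel_yLift_iff`, `oddZeros_yLift_iff`, `yLift_coord_mem_lowDeg`,
`inKernel_lift`, `oddZeros_pad`, `signBit_lift`, `dot2_fold` — support for item 26533

Cell decomp-qadv, seat lens-1 («grading / quantitative ladder»), generation 12 — land port of the node «ScaleDial»
(published under the cell's HOME/decomp-qadv-lens-1/g12/ScaleDial.lean, record NODE-g12.md; RESIDUAL MODE on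
ExactnessDial:26533 `MassStep3u := NoPerfectOdd3 → PolyLossOddU3`).  Prop-defs = the node's rungs / pieces / predicates
only.  No `sorry`, no new axioms, no instances, no notation.  (This part declares NO `Prop`; data defs `bdry`, `yLift`, `extV`, `restrV`, `yPull`, `pad`, `lift`.)
-/

set_option linter.dupNamespace false
set_option linter.style.longLine false

noncomputable section

open scoped Classical

namespace Summit.QuantumAdvantage.QuantumAdvantage.Theorems.ScaleDial

open Finset
open Literature.Computability.QuantumComplexity Literature.Computability.QuantumComplexity.RingHLF
open Literature.Computability.MetaComplexity Literature.Computability.MetaComplexity.Smolensky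
open Summit.QuantumAdvantage.AdviceFreeQNC0
open Summit.QuantumAdvantage.QuantumAdvantage.Theorems.RingPeriodFold (cov covStrat covStrat_mem_lowDeg)
open Summit.QuantumAdvantage.QuantumAdvantage.Theses.ExactnessDial (NoPerfectOdd3 PolyLossOddU3 MassStep3u OddToAll3
  DPLift3 MultiRingBridge3 NoPerfectConst3)

/-! ## The BOTTOM flank: ABSORPTION — `NoPerfectOdd3 ⟺ QML3`

Few odd-class losses are absorbed: if a strategy on `C_{m+1+3k}` loses fewer than `2^k` odd patterns, one of the
`2^k` pairwise-disjoint TOKEN FACES (token `U = SSS`: three `Y`-deletions; token `V = S∘F`: a `00`-fold then a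
`Y`-deletion; both shorten the cycle by `3`, and they are told apart by ONE fixed bit) is loss-free, and the
measurement-calculus transport (`rel_yLift_iff`, `dot2_fold`) pulls the strategy back to a PERFECT strategy on
`C_{m+1}`.  Degree bookkeeping is done on `{0,1}`-valued (indicator) polynomials with a three-slot PROFILE
(site `0` / middle sites / last site), so `3k` deletions cost degree `≤ (3k+1)²·(2d+1)` — polynomial in `k` — and
`k = (log₂ n)^A` deletions stay inside polylog degree: exactness forces `2^((log₂ n)^A)` losses for every `A`. -/

section StitchCore

/-! ### C1. The stitch (local complementation at a `Y`-measured vertex) — lens-1 g10 core, re-derived here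
(HOME/decomp-qadv-lens-1/g10/StitchDial.lean §stitch; Hein–Eisert–Briegel quant-ph/0307130 Prop. 7). -/

variable {m : ℕ}

/-- ScaleDialBA helper `nxt_val` (decomp-qadv land package; see the module docstring). -/
theorem nxt_val {N : ℕ} (b : Fin N) : (RingHLF.nxt b).val = if b.val + 1 = N then 0 else b.val + 1 := by
  have hb := b.isLt
  show (b.val + 1) % N = _
  split_ifs with h
  · rw [h, Nat.mod_self]
  · exact Nat.mod_eq_of_lt (by omega)

/-- ScaleDialBA helper `prv_val` (decomp-qadv land package; see the module docstring). -/
theorem prv_val {N : ℕ} (b : Fin N) : (RingHLF.prv b).val = if b.val = 0 then N - 1 else b.val - 1 := by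
  have hb := b.isLt
  show (b.val + N - 1) % N = _
  split_ifs with h
  · rw [h, Nat.zero_add]; exact Nat.mod_eq_of_lt (by omega)
  · have : b.val + N - 1 = (b.val - 1) + N := by omega
    rw [this, Nat.add_mod_right]; exact Nat.mod_eq_of_lt (by omega)

/-- the two neighbours `0` and `m` of the stitched vertex `m+1`. -/
def bdry (m : ℕ) (i : Fin (m + 1)) : Bool := decide (i.val = 0 ∨ i.val = m)

/-- **Y-lift of a pattern**: `x` on `C_{m+1}` ↦ the pattern on `C_{m+2}` measuring the new vertex `m+1` in `Y`
(`= true`) and its two neighbours `0`, `m` in the FLIPPED basis. -/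
def yLift (x : Fin (m + 1) → Bool) : Fin (m + 2) → Bool :=
  fun b => if h : b.val < m + 1 then xor (x ⟨b.val, h⟩) (bdry m ⟨b.val, h⟩) else true

/-- extension of a kernel vector to the new vertex: `v_{m+1} = v_m ⊕ v_0`. -/
def extV (v : Fin (m + 1) → Bool) : Fin (m + 2) → Bool :=
  fun b => if h : b.val < m + 1 then v ⟨b.val, h⟩ else xor (v (Fin.last m)) (v 0)

/-- restriction to the old vertices. -/
def restrV (w : Fin (m + 2) → Bool) : Fin (m + 1) → Bool := fun i => w (Fin.castSucc i)

/-- **pull-back of an output string** along the stitch: the new vertex's outcome and the flipped basis bit are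
absorbed into the two neighbours. -/
def yPull (x : Fin (m + 1) → Bool) (z' : Fin (m + 2) → Bool) : Fin (m + 1) → Bool :=
  fun i => xor (z' (Fin.castSucc i)) (bdry m i && xor (z' (Fin.last (m + 1))) (x i))

/-- ScaleDialBA helper `yLift_apply_lt` (decomp-qadv land package; see the module docstring). -/
theorem yLift_apply_lt (x : Fin (m + 1) → Bool) {b : Fin (m + 2)} (h : b.val < m + 1) :
    yLift x b = xor (x ⟨b.val, h⟩) (bdry m ⟨b.val, h⟩) := by simp [yLift, h]

/-- ScaleDialBA helper `yLift_apply_eq` (decomp-qadv land package; see the module docstring). -/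
theorem yLift_apply_eq (x : Fin (m + 1) → Bool) {b : Fin (m + 2)} (h : b.val = m + 1) : yLift x b = true := by
  simp [yLift, h]

/-- ScaleDialBA helper `ext_apply_lt` (decomp-qadv land package; see the module docstring). -/
theorem ext_apply_lt (v : Fin (m + 1) → Bool) {b : Fin (m + 2)} (h : b.val < m + 1) : extV v b = v ⟨b.val, h⟩ := by
  simp [extV, h]

/-- ScaleDialBA helper `ext_apply_eq` (decomp-qadv land package; see the module docstring). -/
theorem ext_apply_eq (v : Fin (m + 1) → Bool) {b : Fin (m + 2)} (h : b.val = m + 1) :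
    extV v b = xor (v (Fin.last m)) (v 0) := by
  simp [extV, h]

/-- ScaleDialBA helper `yLift_castSucc` (decomp-qadv land package; see the module docstring). -/
theorem yLift_castSucc (x : Fin (m + 1) → Bool) (i : Fin (m + 1)) : yLift x (Fin.castSucc i) = xor (x i) (bdry m i) := by
  rw [yLift_apply_lt x (by simp [i.isLt])]; rfl

/-- ScaleDialBA helper `yLift_last` (decomp-qadv land package; see the module docstring). -/
theorem yLift_last (x : Fin (m + 1) → Bool) : yLift x (Fin.last (m + 1)) = true := yLift_apply_eq x rfl

/-- ScaleDialBA helper `ext_castSucc` (decomp-qadv land package; see the module docstring). -/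
theorem ext_castSucc (v : Fin (m + 1) → Bool) (i : Fin (m + 1)) : extV v (Fin.castSucc i) = v i := by
  rw [ext_apply_lt v (by simp [i.isLt])]; rfl

/-- ScaleDialBA helper `ext_last` (decomp-qadv land package; see the module docstring). -/
theorem ext_last (v : Fin (m + 1) → Bool) : extV v (Fin.last (m + 1)) = xor (v (Fin.last m)) (v 0) := ext_apply_eq v rfl

/-- ScaleDialBA helper `restr_ext` (decomp-qadv land package; see the module docstring). -/
theorem restr_ext (v : Fin (m + 1) → Bool) : restrV (extV v) = v := by
  funext i; exact ext_castSucc v i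

/-! ### kernel transport -/

/-- the kernel rows of `C_{m+2}` at an old position `b < m+1`, in terms of the old ring. -/
theorem ext_prv (hm : 2 ≤ m) (v : Fin (m + 1) → Bool) (b : Fin (m + 2)) (hb : b.val < m + 1) :
    extV v (RingHLF.prv b) = if b.val = 0 then xor (v (Fin.last m)) (v 0) else v (RingHLF.prv ⟨b.val, hb⟩) := by
  by_cases h0 : b.val = 0
  · have h1 : (RingHLF.prv b).val = m + 1 := by rw [prv_val, if_pos h0]; omega
    rw [ext_apply_eq v h1, if_pos h0]
  · have h1 : (RingHLF.prv b).val = b.val - 1 := by rw [prv_val, if_neg h0]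
    rw [ext_apply_lt v (by omega : (RingHLF.prv b).val < m + 1), if_neg h0]
    congr 1; apply Fin.ext; simp only [prv_val]; split_ifs; omega

/-- ScaleDialBA helper `ext_nxt` (decomp-qadv land package; see the module docstring). -/
theorem ext_nxt (_hm : 2 ≤ m) (v : Fin (m + 1) → Bool) (b : Fin (m + 2)) (hb : b.val < m + 1) :
    extV v (RingHLF.nxt b) = if b.val = m then xor (v (Fin.last m)) (v 0) else v (RingHLF.nxt ⟨b.val, hb⟩) := by
  by_cases h0 : b.val = m
  · have h1 : (RingHLF.nxt b).val = m + 1 := by rw [nxt_val, if_neg (by omega)]; omega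
    rw [ext_apply_eq v h1, if_pos h0]
  · have h1 : (RingHLF.nxt b).val = b.val + 1 := by rw [nxt_val, if_neg (by omega)]
    rw [ext_apply_lt v (by omega : (RingHLF.nxt b).val < m + 1), if_neg h0]
    congr 1; apply Fin.ext; simp only [nxt_val]; split_ifs <;> omega

/-- ScaleDialBA helper `prv_zero_eq_last` (decomp-qadv land package; see the module docstring). -/
theorem prv_zero_eq_last (_hm : 1 ≤ m) : RingHLF.prv (0 : Fin (m + 1)) = Fin.last m := by
  apply Fin.ext; rw [prv_val]; simp

/-- ScaleDialBA helper `nxt_last_eq_zero` (decomp-qadv land package; see the module docstring). -/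
theorem nxt_last_eq_zero : RingHLF.nxt (Fin.last m) = (0 : Fin (m + 1)) := by
  apply Fin.ext; rw [nxt_val]; simp

/-- (K→) kernel vectors extend. -/
theorem inKernel_ext (hm : 2 ≤ m) {x v : Fin (m + 1) → Bool} (h : RingHLF.InKernel x v) :
    RingHLF.InKernel (yLift x) (extV v) := by
  intro b
  by_cases hb : b.val < m + 1
  · rw [ext_prv hm v b hb, ext_nxt hm v b hb, ext_apply_lt v hb, yLift_apply_lt x hb]
    have hrow := h ⟨b.val, hb⟩
    by_cases h0 : b.val = 0
    · have hbm : ¬ b.val = m := by omega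
      rw [if_pos h0, if_neg hbm]
      have e0 : (⟨b.val, hb⟩ : Fin (m + 1)) = 0 := Fin.ext h0
      rw [e0] at hrow ⊢
      rw [prv_zero_eq_last (by omega)] at hrow
      have hb0 : bdry m (0 : Fin (m + 1)) = true := by simp [bdry]
      rw [hb0]
      revert hrow
      generalize v (Fin.last m) = a; generalize v 0 = c; generalize v (RingHLF.nxt 0) = e; generalize x 0 = f
      revert a c e f; decide
    · by_cases hM : b.val = m
      · rw [if_neg h0, if_pos hM]
        have eM : (⟨b.val, hb⟩ : Fin (m + 1)) = Fin.last m := Fin.ext hM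
        rw [eM] at hrow ⊢
        rw [nxt_last_eq_zero] at hrow
        have hbM : bdry m (Fin.last m) = true := by simp [bdry]
        rw [hbM]
        revert hrow
        generalize v (Fin.last m) = a; generalize v 0 = c; generalize v (RingHLF.prv (Fin.last m)) = e
        generalize x (Fin.last m) = f
        revert a c e f; decide
      · rw [if_neg h0, if_neg hM]
        have hbd : bdry m ⟨b.val, hb⟩ = false := by simp [bdry, h0, hM]
        rw [hbd, Bool.xor_false]
        exact hrow
  · have hbv : b.val = m + 1 := by have := b.isLt; omega
    have hp : (RingHLF.prv b).val = m := by rw [prv_val, if_neg (by omega)]; omega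
    have hq : (RingHLF.nxt b).val = 0 := by rw [nxt_val, if_pos (by omega)]
    rw [ext_apply_lt v (by omega : (RingHLF.prv b).val < m + 1), ext_apply_lt v (by omega : (RingHLF.nxt b).val < m + 1),
      ext_apply_eq v hbv, yLift_apply_eq x hbv]
    have e1 : (⟨(RingHLF.prv b).val, by omega⟩ : Fin (m + 1)) = Fin.last m := Fin.ext hp
    have e2 : (⟨(RingHLF.nxt b).val, by omega⟩ : Fin (m + 1)) = 0 := Fin.ext hq
    rw [e1, e2]
    generalize v (Fin.last m) = a; generalize v 0 = c; revert a c; decide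

/-- in the stitched kernel the new coordinate is forced: `w_{m+1} = w_m ⊕ w_0`. -/
theorem ext_restr (hm : 2 ≤ m) {x : Fin (m + 1) → Bool} {w : Fin (m + 2) → Bool}
    (hw : RingHLF.InKernel (yLift x) w) : extV (restrV w) = w := by
  funext b
  by_cases hb : b.val < m + 1
  · rw [ext_apply_lt _ hb]; simp [restrV]
  · have hbv : b.val = m + 1 := by have := b.isLt; omega
    rw [ext_apply_eq _ hbv]
    simp only [restrV]
    have hrow := hw b
    have hp : (RingHLF.prv b).val = m := by rw [prv_val, if_neg (by omega)]; omega
    have hq : (RingHLF.nxt b).val = 0 := by rw [nxt_val, if_pos (by omega)]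
    have e1 : RingHLF.prv b = Fin.castSucc (Fin.last m) := Fin.ext (by rw [hp]; simp)
    have e2 : RingHLF.nxt b = Fin.castSucc 0 := Fin.ext (by rw [hq]; simp)
    rw [e1, e2, yLift_apply_eq x hbv] at hrow
    revert hrow
    generalize w (Fin.castSucc (Fin.last m)) = a; generalize w (Fin.castSucc 0) = c; generalize w b = e
    revert a c e; decide

/-- (K←) kernel vectors of the stitched ring restrict to kernel vectors. -/
theorem inKernel_restr (hm : 2 ≤ m) {x : Fin (m + 1) → Bool} {w : Fin (m + 2) → Bool}
    (hw : RingHLF.InKernel (yLift x) w) : RingHLF.InKernel x (restrV w) := by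
  have hwe := ext_restr hm hw
  set v := restrV w with hv
  intro i
  have hrow := hw (Fin.castSucc i)
  rw [← hwe] at hrow
  have hi : (Fin.castSucc i : Fin (m + 2)).val < m + 1 := by simp [i.isLt]
  rw [ext_prv hm v _ hi, ext_nxt hm v _ hi, ext_apply_lt v hi, yLift_apply_lt x hi] at hrow
  have ei : (⟨(Fin.castSucc i : Fin (m + 2)).val, hi⟩ : Fin (m + 1)) = i := Fin.ext rfl
  rw [ei] at hrow
  by_cases h0 : i.val = 0
  · have hbm : ¬ (Fin.castSucc i : Fin (m + 2)).val = m := by simp; omega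
    rw [if_pos (by simpa using h0), if_neg hbm] at hrow
    have e0 : i = 0 := Fin.ext h0
    rw [e0] at hrow ⊢
    rw [prv_zero_eq_last (by omega)]
    have hb0 : bdry m (0 : Fin (m + 1)) = true := by simp [bdry]
    rw [hb0] at hrow
    revert hrow
    generalize v (Fin.last m) = a; generalize v 0 = c; generalize v (RingHLF.nxt 0) = e; generalize x 0 = f
    revert a c e f; decide
  · by_cases hM : i.val = m
    · rw [if_neg (by simpa using h0), if_pos (by simpa using hM)] at hrow
      have eM : i = Fin.last m := Fin.ext hM
      rw [eM] at hrow ⊢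
      rw [nxt_last_eq_zero]
      have hbM : bdry m (Fin.last m) = true := by simp [bdry]
      rw [hbM] at hrow
      revert hrow
      generalize v (Fin.last m) = a; generalize v 0 = c; generalize v (RingHLF.prv (Fin.last m)) = e
      generalize x (Fin.last m) = f
      revert a c e f; decide
    · rw [if_neg (by simpa using h0), if_neg (by simpa using hM)] at hrow
      have hbd : bdry m i = false := by simp [bdry, h0, hM]
      rw [hbd, Bool.xor_false] at hrow
      exact hrow

/-! ### counts across the stitch -/

/-- ScaleDialBA helper `last_ne_zero` (decomp-qadv land package; see the module docstring). -/
theorem last_ne_zero (hm : 1 ≤ m) : (Fin.last m : Fin (m + 1)) ≠ 0 := by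
  intro h; have := congrArg Fin.val h; simp at this; omega

/-- peel the two boundary positions `0` and `m` off a sum over `Fin (m+1)`. -/
theorem sum_peel (hm : 1 ≤ m) (f : Fin (m + 1) → ℕ) :
    ∑ i, f i = f 0 + f (Fin.last m) + ∑ i ∈ ((univ : Finset (Fin (m + 1))).erase 0).erase (Fin.last m), f i := by
  have h0 : (0 : Fin (m + 1)) ∈ (univ : Finset (Fin (m + 1))) := mem_univ _
  have hL : Fin.last m ∈ (univ : Finset (Fin (m + 1))).erase 0 := mem_erase.2 ⟨last_ne_zero hm, mem_univ _⟩
  rw [← add_sum_erase _ _ h0, ← add_sum_erase _ _ hL, add_assoc]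

/-- ScaleDialBA helper `bdry_zero` (decomp-qadv land package; see the module docstring). -/
theorem bdry_zero : bdry m (0 : Fin (m + 1)) = true := by simp [bdry]
/-- ScaleDialBA helper `bdry_last` (decomp-qadv land package; see the module docstring). -/
theorem bdry_last : bdry m (Fin.last m) = true := by simp [bdry]
/-- ScaleDialBA helper `bdry_mid` (decomp-qadv land package; see the module docstring). -/
theorem bdry_mid {i : Fin (m + 1)} (hi : i ∈ ((univ : Finset (Fin (m + 1))).erase 0).erase (Fin.last m)) :
    bdry m i = false := by
  have h1 : i ≠ Fin.last m := (mem_erase.1 hi).1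
  have h2 : i ≠ 0 := (mem_erase.1 (mem_erase.1 hi).2).1
  have h1' : i.val ≠ m := fun h => h1 (Fin.ext (by simp [h]))
  have h2' : i.val ≠ 0 := fun h => h2 (Fin.ext (by simp [h]))
  simp [bdry, h1', h2']

/-- ScaleDialBA helper `ext_nxt_cc` (decomp-qadv land package; see the module docstring). -/
theorem ext_nxt_cc (hm : 2 ≤ m) (v : Fin (m + 1) → Bool) (j : Fin m) :
    extV v (RingHLF.nxt (Fin.castSucc (Fin.castSucc j))) = v (RingHLF.nxt (Fin.castSucc j)) := by
  have hj := j.isLt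
  have hj' : (Fin.castSucc (Fin.castSucc j) : Fin (m + 2)).val < m + 1 := by
    simp only [Fin.val_castSucc]; omega
  rw [ext_nxt hm v _ hj', if_neg (by simp only [Fin.val_castSucc]; omega)]
  congr 2

/-- ScaleDialBA helper `ext_nxt_clast` (decomp-qadv land package; see the module docstring). -/
theorem ext_nxt_clast (hm : 2 ≤ m) (v : Fin (m + 1) → Bool) :
    extV v (RingHLF.nxt (Fin.castSucc (Fin.last m))) = xor (v (Fin.last m)) (v 0) := by
  rw [ext_nxt hm v _ (by simp), if_pos (by simp)]

/-- (E) edges: the old edge `{m, 0}` is replaced by the path `m — (m+1) — 0`. -/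
theorem edgesIn_ext (hm : 2 ≤ m) (v : Fin (m + 1) → Bool) :
    RingHLF.edgesIn (extV v) + (if v (Fin.last m) = true ∧ v 0 = true then 1 else 0) =
      RingHLF.edgesIn v + (if v (Fin.last m) = true ∧ (xor (v (Fin.last m)) (v 0)) = true then 1 else 0) +
        (if (xor (v (Fin.last m)) (v 0)) = true ∧ v 0 = true then 1 else 0) := by
  unfold RingHLF.edgesIn
  rw [card_filter, card_filter, Fin.sum_univ_castSucc, Fin.sum_univ_castSucc, Fin.sum_univ_castSucc]
  have hL4 : extV v (RingHLF.nxt (Fin.last (m + 1))) = v 0 := by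
    rw [nxt_last_eq_zero, ← Fin.castSucc_zero, ext_castSucc]
  have hL5 : v (RingHLF.nxt (Fin.last m)) = v 0 := by rw [nxt_last_eq_zero]
  simp only [ext_castSucc, ext_nxt_cc hm, ext_nxt_clast hm, ext_last, hL4, hL5]
  omega

/-- (W) basis weights: the two flipped neighbours and the new `Y` vertex. -/
theorem wtAnd_ext (hm : 2 ≤ m) (x v : Fin (m + 1) → Bool) :
    RingHLF.wtAnd (yLift x) (extV v) + (if x 0 = true ∧ v 0 = true then 1 else 0) +
        (if x (Fin.last m) = true ∧ v (Fin.last m) = true then 1 else 0) =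
      RingHLF.wtAnd x v + (if x 0 = false ∧ v 0 = true then 1 else 0) +
        (if x (Fin.last m) = false ∧ v (Fin.last m) = true then 1 else 0) +
        (if (xor (v (Fin.last m)) (v 0)) = true then 1 else 0) := by
  unfold RingHLF.wtAnd
  rw [card_filter, card_filter, Fin.sum_univ_castSucc]
  simp only [yLift_castSucc, ext_castSucc, yLift_last, ext_last, true_and]
  rw [sum_peel (by omega) (fun i => if (xor (x i) (bdry m i)) = true ∧ v i = true then 1 else 0),
    sum_peel (by omega) (fun i => if x i = true ∧ v i = true then 1 else 0)]
  have hmid : ∑ i ∈ ((univ : Finset (Fin (m + 1))).erase 0).erase (Fin.last m),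
      (if (xor (x i) (bdry m i)) = true ∧ v i = true then 1 else 0) =
      ∑ i ∈ ((univ : Finset (Fin (m + 1))).erase 0).erase (Fin.last m), (if x i = true ∧ v i = true then 1 else 0) := by
    refine sum_congr rfl fun i hi => ?_
    rw [bdry_mid hi, Bool.xor_false]
  rw [hmid, bdry_zero, bdry_last]
  generalize ∑ i ∈ ((univ : Finset (Fin (m + 1))).erase 0).erase (Fin.last m), (if x i = true ∧ v i = true then 1 else 0) = M
  cases x 0 <;> cases v 0 <;> cases x (Fin.last m) <;> cases v (Fin.last m) <;> simp <;> omega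


end StitchCore
end Summit.QuantumAdvantage.QuantumAdvantage.Theorems.ScaleDial
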